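/-
Copyright: the b2b-balaban T⁴-continuum CRUX team, row NE7b OWNER lineage `t4-ne7b-p1` (gen 143). Project licence.
-/
import Summits.QuantumFields.BalabanUV.T4Continuum.Spine.NE7b.SupHessianVectorGeometryLetters
import Summits.QuantumFields.BalabanUV.T4Continuum.Spine.NE7b.SupFourPointTreeRowSum

/-!
# SUPPORT-COUNTED QUADRUPLE SUMS (SCOPING (d14)(2)(iv); finite sums — the order-5 analogue of (510) §2).  The three- and four-point ENTRIES of
# `∂⁵W`'s kernel letter ((567)∕(568)∕(570)∕(571): `≤ C∕(ρρ)` at a triangle rooted at the row index `x`; (572)∕(573): `≤ C·Σ_T Πq` over the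
# sixteen trees on four sites) carry vertex observables that VANISH off a finite support: the Hessian entry `U″[e_a,e_b]` off `{Hk_{ba} ≠ 0}`
# (at most `n` values of `b`), the third-derivative entry `U‴[e_a,e_b,e_c]` off `{K3_{bca} ≠ 0}` (at most `n₃` pairs `(b,c)`).  Their fixed-`x`
# QUADRUPLE sums are then volume-uniform; here the six counting lemmas, for an abstract array `T_{yzts}`, abstract support predicates and the site
# letter `Σ_vρ_{xv}⁻¹ ≤ S` (resp. the tree weight's row∕column sums `≤ S`):
#   pair support × triangle (`≤ N·C·S²`), nested pair support × triangle (`≤ N·C·S²`), two single supports × triangle (`≤ N·N·C·S²`, two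
#   placements), single support × sixteen trees (`≤ N·C·16S³`, two placements)
# (row NE7b, node U5c; (463) `tree_double_sum_le`, (488) `tree_sum_row_le` BY NAME; [folklore] finite sums)

Cell `pub-balaban`, sub-cell `t4`, spine estimate NE7b (`T4WeightBudget.RelWeightBound`; the cell's OWN estimate — NOT PRINTED in
[Bałaban 1983–89], NOT PROVED).  Crux-route work under `Spine/NE7b/` by the row OWNER (`t4-ne7b-p1` gen 143, file (574)) under FREEZE
(0)'s crux-prover clause; NOTHING of Bałaban's is named as a Lean object, valued or asserted; no `T4Continuum/Support` leaf typed; no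
`def`, no notation; zero `sorry`.  Imports (BY NAME): the OWNER's (510) `…SupHessianVectorGeometryLetters` (for (463) `tree_double_sum_le`),
(488) `…SupFourPointTreeRowSum` (`tree_sum_row_le`).

WHAT IS PROVED ([folklore]; finite sums): §1 `filter_sum_eq`, `card_mul_le`; §2 **`pair_support_triangle_sum_le`**,
**`nested_pair_support_triangle_sum_le`**, **`two_supports_triangle_sum_le`**, **`two_supports_triangle_sum_le_two`**; §3
**`support_tree16_sum_le`**, **`support_tree16_sum_le_two`**; §4 toy.

HONEST (what this is NOT).  Counting only; the instantiations (the row letters of the order-5 three- and four-point pieces) are the next files; the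
FORM of `∂⁵W` and the assembly are NOT typed.  Scalar skeleton ((A3), NC-NE7b-α UNRULED); nothing of Bałaban's asserted.  BY-NAME EFFECT ON THE
WALL: NONE.  NE7b NOT PRINTED ∕ NOT PROVED; spine PROVED 0∕9; rung (B)+1 — the programme's measures remain FINITE-torus statements; NOT the mass gap,
NOT Clay.  HONEST DEPENDENCY: continuum YM on T⁴ ⇐ BetaPertH ∧ nine spine estimates (0∕9 proved); BetaPertH ⇐ (D1) ∧ (D4) ∧ CAP+tail; G-an2-4
gates asym, D1 and NE2∕3∕4.
-/

set_option autoImplicit false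

namespace Summit.QuantumFields.BalabanUV.T4Continuum.NE7b.SupSupportCountedQuadrupleSums

open Finset
open scoped BigOperators
open SupThirdCumulantTreeDecay (tree_double_sum_le)
open SupFourPointTreeRowSum (tree_sum_row_le)

variable {ι : Type} [Fintype ι]

/-! ## §1. Two counting helpers -/

/-- A sum whose terms vanish off a decidable support equals the sum over the support. [folklore] -/
theorem filter_sum_eq (P : ι → Prop) [DecidablePred P] (f : ι → ℝ) (h0 : ∀ y, ¬P y → f y = 0) :
    ∑ y, f y = ∑ y ∈ Finset.univ.filter P, f y := by
  rw [Finset.sum_filter]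
  refine Finset.sum_congr rfl fun y _ => ?_
  split_ifs with h
  · rfl
  · exact h0 y h

omit [Fintype ι] in
/-- Summing a uniform bound over a support: `Σ_{y ∈ supp} f ≤ |supp|·B` for `f ≤ B` on the support. [folklore] -/
theorem card_mul_le (s : Finset ι) (f : ι → ℝ) {B : ℝ} (hf : ∀ y ∈ s, f y ≤ B) : ∑ y ∈ s, f y ≤ (s.card : ℝ) * B :=
  calc ∑ y ∈ s, f y ≤ ∑ _y ∈ s, B := Finset.sum_le_sum hf
    _ = (s.card : ℝ) * B := by rw [Finset.sum_const, nsmul_eq_mul]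

/-! ## §2. Triangle entries -/

section Triangle

variable {ρ : ι → ι → ℝ} {C S N : ℝ}

/-- **PAIR SUPPORT IN `(y,z)`, TRIANGLE IN `(t,s)`**: `T_{yzts} = 0` unless `K_{yz} ≠ 0` (`Σ_y #{z} ≤ N` pairs), `|T| ≤ C∕(ρ_{xt}ρ_{xs})`,
`Σ_vρ_{xv}⁻¹ ≤ S` give `Σ_{y,z,t,s}|T| ≤ N·(C·S²)`. [folklore] -/
theorem pair_support_triangle_sum_le (T : ι → ι → ι → ι → ℝ) (K : ι → ι → ℝ) (x : ι) (hC : 0 ≤ C) (hρ1 : ∀ x y, 1 ≤ ρ x y)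
    (hS : ∑ v, 1 / ρ x v ≤ S) (h0 : ∀ y z, K y z = 0 → ∀ t s, T y z t s = 0) (hT : ∀ y z t s, |T y z t s| ≤ C / (ρ x t * ρ x s))
    (hn : ∑ y, ((Finset.univ.filter (fun z => K y z ≠ 0)).card : ℝ) ≤ N) :
    ∑ y, ∑ z, ∑ t, ∑ s, |T y z t s| ≤ N * (C * S ^ 2) := by
  classical
  have hin : ∀ y z, ∑ t, ∑ s, |T y z t s| ≤ C * S ^ 2 := fun y z =>
    (Finset.sum_le_sum fun t _ => Finset.sum_le_sum fun s _ => hT y z t s).trans (tree_double_sum_le hC hρ1 x hS)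
  have hCS : 0 ≤ C * S ^ 2 := by positivity
  have hy : ∀ y, ∑ z, ∑ t, ∑ s, |T y z t s| ≤ ((Finset.univ.filter (fun z => K y z ≠ 0)).card : ℝ) * (C * S ^ 2) := fun y => by
    rw [filter_sum_eq (fun z => K y z ≠ 0) (fun z => ∑ t, ∑ s, |T y z t s|) (fun z hz =>
      Finset.sum_eq_zero fun t _ => Finset.sum_eq_zero fun s _ => by rw [h0 y z (not_not.1 hz) t s, abs_zero])]
    exact card_mul_le _ _ fun z _ => hin y z
  calc ∑ y, ∑ z, ∑ t, ∑ s, |T y z t s| ≤ ∑ y, ((Finset.univ.filter (fun z => K y z ≠ 0)).card : ℝ) * (C * S ^ 2) :=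
        Finset.sum_le_sum fun y _ => hy y
    _ = (∑ y, ((Finset.univ.filter (fun z => K y z ≠ 0)).card : ℝ)) * (C * S ^ 2) := by rw [Finset.sum_mul]
    _ ≤ N * (C * S ^ 2) := mul_le_mul_of_nonneg_right hn hCS

/-- **NESTED PAIR SUPPORT IN `(z,t)` FOR EVERY `y`, TRIANGLE IN `(y,s)`**: `T_{yzts} = 0` unless `K_{yzt} ≠ 0` (`Σ_z #{t} ≤ N` for every `y`),
`|T| ≤ C∕(ρ_{xy}ρ_{xs})` give `Σ_{y,z,t,s}|T| ≤ N·(C·S²)`. [folklore] -/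
theorem nested_pair_support_triangle_sum_le (T : ι → ι → ι → ι → ℝ) (K : ι → ι → ι → ℝ) (x : ι) (hC : 0 ≤ C) (hρ1 : ∀ x y, 1 ≤ ρ x y)
    (hS : ∑ v, 1 / ρ x v ≤ S) (h0 : ∀ y z t, K y z t = 0 → ∀ s, T y z t s = 0) (hT : ∀ y z t s, |T y z t s| ≤ C / (ρ x y * ρ x s))
    (hn : ∀ y, ∑ z, ((Finset.univ.filter (fun t => K y z t ≠ 0)).card : ℝ) ≤ N) :
    ∑ y, ∑ z, ∑ t, ∑ s, |T y z t s| ≤ N * (C * S ^ 2) := by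
  classical
  have hρ0 : ∀ v, 0 ≤ 1 / ρ x v := fun v => div_nonneg zero_le_one (zero_le_one.trans (hρ1 x v))
  have hS0 : 0 ≤ S := (Finset.sum_nonneg fun v _ => hρ0 v).trans hS
  have hN0 : 0 ≤ N := (Finset.sum_nonneg fun z _ => Nat.cast_nonneg _).trans (hn x)
  -- fixed `y, z, t` in the support: `Σ_s |T| ≤ C/ρ_xy · S`
  have hin : ∀ y z t, ∑ s, |T y z t s| ≤ C / ρ x y * S := fun y z t => by
    have hCy : 0 ≤ C / ρ x y := div_nonneg hC (zero_le_one.trans (hρ1 x y))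
    calc ∑ s, |T y z t s| ≤ ∑ s, C / ρ x y * (1 / ρ x s) := Finset.sum_le_sum fun s _ => by
            rw [div_mul_div_comm, mul_one]; exact hT y z t s
      _ = C / ρ x y * ∑ s, 1 / ρ x s := (Finset.mul_sum _ _ _).symm
      _ ≤ C / ρ x y * S := mul_le_mul_of_nonneg_left hS hCy
  -- fixed `y, z`: count the support in `t`
  have hyz : ∀ y z, ∑ t, ∑ s, |T y z t s| ≤ ((Finset.univ.filter (fun t => K y z t ≠ 0)).card : ℝ) * (C / ρ x y * S) := fun y z => by
    rw [filter_sum_eq (fun t => K y z t ≠ 0) (fun t => ∑ s, |T y z t s|) (fun t ht =>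
      Finset.sum_eq_zero fun s _ => by rw [h0 y z t (not_not.1 ht) s, abs_zero])]
    exact card_mul_le _ _ fun t _ => hin y z t
  -- fixed `y`: `≤ N · C/ρ_xy · S`
  have hy : ∀ y, ∑ z, ∑ t, ∑ s, |T y z t s| ≤ N * (C / ρ x y * S) := fun y => by
    have hCyS : 0 ≤ C / ρ x y * S := mul_nonneg (div_nonneg hC (zero_le_one.trans (hρ1 x y))) hS0
    calc ∑ z, ∑ t, ∑ s, |T y z t s| ≤ ∑ z, ((Finset.univ.filter (fun t => K y z t ≠ 0)).card : ℝ) * (C / ρ x y * S) :=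
          Finset.sum_le_sum fun z _ => hyz y z
      _ = (∑ z, ((Finset.univ.filter (fun t => K y z t ≠ 0)).card : ℝ)) * (C / ρ x y * S) := by rw [Finset.sum_mul]
      _ ≤ N * (C / ρ x y * S) := mul_le_mul_of_nonneg_right (hn y) hCyS
  calc ∑ y, ∑ z, ∑ t, ∑ s, |T y z t s| ≤ ∑ y, N * (C / ρ x y * S) := Finset.sum_le_sum fun y _ => hy y
    _ = N * (C * S) * ∑ y, 1 / ρ x y := by
        rw [Finset.mul_sum]
        exact Finset.sum_congr rfl fun y _ => by ring
    _ ≤ N * (C * S) * S := mul_le_mul_of_nonneg_left hS (by positivity)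
    _ = N * (C * S ^ 2) := by ring

/-- **SINGLE SUPPORTS IN `y` (against `x`) AND IN `t` (against `z`), TRIANGLE IN `(z,s)`**: `T_{yzts} = 0` unless `K¹_y ≠ 0` (`≤ N` values)
and `K²_{zt} ≠ 0` (`≤ N` values of `t` for every `z`), `|T| ≤ C∕(ρ_{xz}ρ_{xs})` give `Σ_{y,z,t,s}|T| ≤ N·N·(C·S²)`. [folklore] -/
theorem two_supports_triangle_sum_le (T : ι → ι → ι → ι → ℝ) (K₁ : ι → ℝ) (K₂ : ι → ι → ℝ) (x : ι) (hC : 0 ≤ C) (hρ1 : ∀ x y, 1 ≤ ρ x y)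
    (hS : ∑ v, 1 / ρ x v ≤ S) (h01 : ∀ y, K₁ y = 0 → ∀ z t s, T y z t s = 0) (h02 : ∀ z t, K₂ z t = 0 → ∀ y s, T y z t s = 0)
    (hT : ∀ y z t s, |T y z t s| ≤ C / (ρ x z * ρ x s)) (hn1 : ((Finset.univ.filter (fun y => K₁ y ≠ 0)).card : ℝ) ≤ N)
    (hn2 : ∀ z, ((Finset.univ.filter (fun t => K₂ z t ≠ 0)).card : ℝ) ≤ N) :
    ∑ y, ∑ z, ∑ t, ∑ s, |T y z t s| ≤ N * N * (C * S ^ 2) := by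
  classical
  have hρ0 : ∀ v, 0 ≤ 1 / ρ x v := fun v => div_nonneg zero_le_one (zero_le_one.trans (hρ1 x v))
  have hS0 : 0 ≤ S := (Finset.sum_nonneg fun v _ => hρ0 v).trans hS
  have hN0 : 0 ≤ N := (Nat.cast_nonneg _).trans hn1
  have hin : ∀ y z t, ∑ s, |T y z t s| ≤ C / ρ x z * S := fun y z t => by
    have hCz : 0 ≤ C / ρ x z := div_nonneg hC (zero_le_one.trans (hρ1 x z))
    calc ∑ s, |T y z t s| ≤ ∑ s, C / ρ x z * (1 / ρ x s) := Finset.sum_le_sum fun s _ => by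
            rw [div_mul_div_comm, mul_one]; exact hT y z t s
      _ = C / ρ x z * ∑ s, 1 / ρ x s := (Finset.mul_sum _ _ _).symm
      _ ≤ C / ρ x z * S := mul_le_mul_of_nonneg_left hS hCz
  -- fixed `y, z`: the support in `t`
  have hyz : ∀ y z, ∑ t, ∑ s, |T y z t s| ≤ N * (C / ρ x z * S) := fun y z => by
    have hCzS : 0 ≤ C / ρ x z * S := mul_nonneg (div_nonneg hC (zero_le_one.trans (hρ1 x z))) hS0
    rw [filter_sum_eq (fun t => K₂ z t ≠ 0) (fun t => ∑ s, |T y z t s|) (fun t ht =>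
      Finset.sum_eq_zero fun s _ => by rw [h02 z t (not_not.1 ht) y s, abs_zero])]
    exact (card_mul_le _ _ fun t _ => hin y z t).trans (mul_le_mul_of_nonneg_right (hn2 z) hCzS)
  -- fixed `y`: the triangle's second edge summed
  have hy : ∀ y, ∑ z, ∑ t, ∑ s, |T y z t s| ≤ N * (C * S ^ 2) := fun y =>
    calc ∑ z, ∑ t, ∑ s, |T y z t s| ≤ ∑ z, N * (C / ρ x z * S) := Finset.sum_le_sum fun z _ => hyz y z
      _ = N * (C * S) * ∑ z, 1 / ρ x z := by
          rw [Finset.mul_sum]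
          exact Finset.sum_congr rfl fun z _ => by ring
      _ ≤ N * (C * S) * S := mul_le_mul_of_nonneg_left hS (by positivity)
      _ = N * (C * S ^ 2) := by ring
  have hNCS : 0 ≤ N * (C * S ^ 2) := by positivity
  -- the support in `y`
  rw [filter_sum_eq (fun y => K₁ y ≠ 0) (fun y => ∑ z, ∑ t, ∑ s, |T y z t s|) (fun y hy =>
    Finset.sum_eq_zero fun z _ => Finset.sum_eq_zero fun t _ => Finset.sum_eq_zero fun s _ => by rw [h01 y (not_not.1 hy) z t s, abs_zero])]
  calc ∑ y ∈ Finset.univ.filter (fun y => K₁ y ≠ 0), ∑ z, ∑ t, ∑ s, |T y z t s|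
      ≤ ((Finset.univ.filter (fun y => K₁ y ≠ 0)).card : ℝ) * (N * (C * S ^ 2)) := card_mul_le _ _ fun y _ => hy y
    _ ≤ N * (N * (C * S ^ 2)) := mul_le_mul_of_nonneg_right hn1 hNCS
    _ = N * N * (C * S ^ 2) := by ring

/-- **SINGLE SUPPORTS IN `z` (against `y`) AND IN `s` (against `t`), TRIANGLE IN `(y,t)`**: `T_{yzts} = 0` unless `K¹_{yz} ≠ 0` (`≤ N` values of
`z` for every `y`) and `K²_{ts} ≠ 0` (`≤ N` values of `s` for every `t`), `|T| ≤ C∕(ρ_{xy}ρ_{xt})` give `Σ_{y,z,t,s}|T| ≤ N·N·(C·S²)`. [folklore] -/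
theorem two_supports_triangle_sum_le_two (T : ι → ι → ι → ι → ℝ) (K₁ K₂ : ι → ι → ℝ) (x : ι) (hC : 0 ≤ C) (hρ1 : ∀ x y, 1 ≤ ρ x y)
    (hS : ∑ v, 1 / ρ x v ≤ S) (h01 : ∀ y z, K₁ y z = 0 → ∀ t s, T y z t s = 0) (h02 : ∀ t s, K₂ t s = 0 → ∀ y z, T y z t s = 0)
    (hT : ∀ y z t s, |T y z t s| ≤ C / (ρ x y * ρ x t)) (hn1 : ∀ y, ((Finset.univ.filter (fun z => K₁ y z ≠ 0)).card : ℝ) ≤ N)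
    (hn2 : ∀ t, ((Finset.univ.filter (fun s => K₂ t s ≠ 0)).card : ℝ) ≤ N) :
    ∑ y, ∑ z, ∑ t, ∑ s, |T y z t s| ≤ N * N * (C * S ^ 2) := by
  classical
  have hρ0 : ∀ v, 0 ≤ 1 / ρ x v := fun v => div_nonneg zero_le_one (zero_le_one.trans (hρ1 x v))
  have hS0 : 0 ≤ S := (Finset.sum_nonneg fun v _ => hρ0 v).trans hS
  have hN0 : 0 ≤ N := (Nat.cast_nonneg _).trans (hn1 x)
  -- fixed `y, z, t`: the support in `s`
  have hin : ∀ y z t, ∑ s, |T y z t s| ≤ N * (C / (ρ x y * ρ x t)) := fun y z t => by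
    have hCyt : 0 ≤ C / (ρ x y * ρ x t) := div_nonneg hC (mul_nonneg (zero_le_one.trans (hρ1 x y)) (zero_le_one.trans (hρ1 x t)))
    rw [filter_sum_eq (fun s => K₂ t s ≠ 0) (fun s => |T y z t s|) (fun s hs => by rw [h02 t s (not_not.1 hs) y z, abs_zero])]
    exact (card_mul_le _ _ fun s _ => hT y z t s).trans (mul_le_mul_of_nonneg_right (hn2 t) hCyt)
  -- fixed `y, z`: sum the edge `(x,t)`
  have hyz : ∀ y z, ∑ t, ∑ s, |T y z t s| ≤ N * (C / ρ x y) * S := fun y z => by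
    have hf : 0 ≤ N * (C / ρ x y) := mul_nonneg hN0 (div_nonneg hC (zero_le_one.trans (hρ1 x y)))
    calc ∑ t, ∑ s, |T y z t s| ≤ ∑ t, N * (C / (ρ x y * ρ x t)) := Finset.sum_le_sum fun t _ => hin y z t
      _ = N * (C / ρ x y) * ∑ t, 1 / ρ x t := by
          rw [Finset.mul_sum]
          exact Finset.sum_congr rfl fun t _ => by rw [div_mul_eq_div_div]; ring
      _ ≤ N * (C / ρ x y) * S := mul_le_mul_of_nonneg_left hS hf
  -- fixed `y`: the support in `z`
  have hy : ∀ y, ∑ z, ∑ t, ∑ s, |T y z t s| ≤ N * (N * (C / ρ x y) * S) := fun y => by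
    have hf : 0 ≤ N * (C / ρ x y) * S := mul_nonneg (mul_nonneg hN0 (div_nonneg hC (zero_le_one.trans (hρ1 x y)))) hS0
    rw [filter_sum_eq (fun z => K₁ y z ≠ 0) (fun z => ∑ t, ∑ s, |T y z t s|) (fun z hz =>
      Finset.sum_eq_zero fun t _ => Finset.sum_eq_zero fun s _ => by rw [h01 y z (not_not.1 hz) t s, abs_zero])]
    exact (card_mul_le _ _ fun z _ => hyz y z).trans (mul_le_mul_of_nonneg_right (hn1 y) hf)
  calc ∑ y, ∑ z, ∑ t, ∑ s, |T y z t s| ≤ ∑ y, N * (N * (C / ρ x y) * S) := Finset.sum_le_sum fun y _ => hy y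
    _ = N * N * (C * S) * ∑ y, 1 / ρ x y := by
        rw [Finset.mul_sum]
        exact Finset.sum_congr rfl fun y _ => by ring
    _ ≤ N * N * (C * S) * S := mul_le_mul_of_nonneg_left hS (by positivity)
    _ = N * N * (C * S ^ 2) := by ring

end Triangle

/-! ## §3. Tree entries on four sites -/

section Trees

variable {q : ι → ι → ℝ} {C S N : ℝ}

/-- **SINGLE SUPPORT IN `y` (against `x`), SIXTEEN TREES ON `{x,z,t,s}`**: `T_{yzts} = 0` unless `K_y ≠ 0` (`≤ N` values), `|T| ≤ C·Σ_TΠq`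
(the tree weight `q ≥ 0` with row and column sums `≤ S`) give `Σ_{y,z,t,s}|T| ≤ N·(C·(16·S³))`. [folklore] -/
theorem support_tree16_sum_le (T : ι → ι → ι → ι → ℝ) (K : ι → ℝ) (x : ι) (hC : 0 ≤ C) (hq : ∀ u v, 0 ≤ q u v) (hSr : ∀ u, ∑ v, q u v ≤ S)
    (hSc : ∀ v, ∑ u, q u v ≤ S) (h0 : ∀ y, K y = 0 → ∀ z t s, T y z t s = 0)
    (hT : ∀ y z t s, |T y z t s| ≤ C * (q x z * q x t * q x s + q x z * q z t * q z s + q x t * q z t * q t s + q x s * q z s * q t s + q x z * q z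
      t * q t s + q x z * q z s * q t s + q x t * q z t * q z s + q x t * q z s * q t s + q x s * q z t * q z s + q x s * q z t * q t s + q x z * q x
          t *
      q t s + q x z * q x s * q t s + q x z * q x t * q z s + q x t * q x s * q z s + q x z * q x s * q z t + q x t * q x s * q z t))
    (hn : ((Finset.univ.filter (fun y => K y ≠ 0)).card : ℝ) ≤ N) :
    ∑ y, ∑ z, ∑ t, ∑ s, |T y z t s| ≤ N * (C * (16 * S ^ 3)) := by
  classical
  have hS0 : 0 ≤ S := (Finset.sum_nonneg fun v _ => hq x v).trans (hSr x)
  have htree := tree_sum_row_le hq hSr hSc x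
  have hin : ∀ y, ∑ z, ∑ t, ∑ s, |T y z t s| ≤ C * (16 * S ^ 3) := fun y => by
    refine (Finset.sum_le_sum fun z _ => Finset.sum_le_sum fun t _ => Finset.sum_le_sum fun s _ => hT y z t s).trans ?_
    simp_rw [← Finset.mul_sum]
    exact mul_le_mul_of_nonneg_left htree hC
  have hCS : 0 ≤ C * (16 * S ^ 3) := by positivity
  rw [filter_sum_eq (fun y => K y ≠ 0) (fun y => ∑ z, ∑ t, ∑ s, |T y z t s|) (fun y hy =>
    Finset.sum_eq_zero fun z _ => Finset.sum_eq_zero fun t _ => Finset.sum_eq_zero fun s _ => by rw [h0 y (not_not.1 hy) z t s, abs_zero])]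
  exact (card_mul_le _ _ fun y _ => hin y).trans (mul_le_mul_of_nonneg_right hn hCS)

/-- **SINGLE SUPPORT IN `z` (against `y`), SIXTEEN TREES ON `{x,y,t,s}`**: `T_{yzts} = 0` unless `K_{yz} ≠ 0` (`≤ N` values of `z` for every
`y`), `|T| ≤ C·Σ_TΠq` on the sites `x, y, t, s` give `Σ_{y,z,t,s}|T| ≤ N·(C·(16·S³))`. [folklore] -/
theorem support_tree16_sum_le_two (T : ι → ι → ι → ι → ℝ) (K : ι → ι → ℝ) (x : ι) (hC : 0 ≤ C) (hq : ∀ u v, 0 ≤ q u v)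
    (hSr : ∀ u, ∑ v, q u v ≤ S) (hSc : ∀ v, ∑ u, q u v ≤ S) (h0 : ∀ y z, K y z = 0 → ∀ t s, T y z t s = 0)
    (hT : ∀ y z t s, |T y z t s| ≤ C * (q x y * q x t * q x s + q x y * q y t * q y s + q x t * q y t * q t s + q x s * q y s * q t s + q x y * q y
      t * q t s + q x y * q y s * q t s + q x t * q y t * q y s + q x t * q y s * q t s + q x s * q y t * q y s + q x s * q y t * q t s + q x y * q x
          t *
      q t s + q x y * q x s * q t s + q x y * q x t * q y s + q x t * q x s * q y s + q x y * q x s * q y t + q x t * q x s * q y t))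
    (hn : ∀ y, ((Finset.univ.filter (fun z => K y z ≠ 0)).card : ℝ) ≤ N) :
    ∑ y, ∑ z, ∑ t, ∑ s, |T y z t s| ≤ N * (C * (16 * S ^ 3)) := by
  classical
  have hN0 : 0 ≤ N := (Nat.cast_nonneg _).trans (hn x)
  have htree := tree_sum_row_le hq hSr hSc x
  -- fixed `y`: the support in `z`, each term bounded by the tree polynomial at `(x; y, t, s)` summed over `t, s`
  have hP : ∀ y t s, 0 ≤ C * (q x y * q x t * q x s + q x y * q y t * q y s + q x t * q y t * q t s + q x s * q y s * q t s + q x y * q y t * q t s +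
      q x y * q y s * q t s + q x t * q y t * q y s + q x t * q y s * q t s + q x s * q y t * q y s + q x s * q y t * q t s + q x y * q x t * q t s +
          q x
      y * q x s * q t s + q x y * q x t * q y s + q x t * q x s * q y s + q x y * q x s * q y t + q x t * q x s * q y t) := fun y t s => by
    have := hq x y; have := hq x t; have := hq x s; have := hq y t; have := hq y s; have := hq t s
    positivity
  have hy : ∀ y, ∑ z, ∑ t, ∑ s, |T y z t s| ≤ N * ∑ t, ∑ s, C * (q x y * q x t * q x s + q x y * q y t * q y s + q x t * q y t * q t s + q x s * q
      y s * q t s + q x y * q y t * q t s + q x y * q y s * q t s + q x t * q y t * q y s + q x t * q y s * q t s + q x s * q y t * q y s + q x s * q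
          y
      t * q t s + q x y * q x t * q t s + q x y * q x s * q t s + q x y * q x t * q y s + q x t * q x s * q y s + q x y * q x s * q y t + q x t * q x
          s *
      q y t) := fun y => by
    rw [filter_sum_eq (fun z => K y z ≠ 0) (fun z => ∑ t, ∑ s, |T y z t s|) (fun z hz =>
      Finset.sum_eq_zero fun t _ => Finset.sum_eq_zero fun s _ => by rw [h0 y z (not_not.1 hz) t s, abs_zero])]
    exact (card_mul_le _ _ fun z _ => Finset.sum_le_sum fun t _ => Finset.sum_le_sum fun s _ => hT y z t s).trans
      (mul_le_mul_of_nonneg_right (hn y) (Finset.sum_nonneg fun t _ => Finset.sum_nonneg fun s _ => hP y t s))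
  calc ∑ y, ∑ z, ∑ t, ∑ s, |T y z t s| ≤ ∑ y, N * ∑ t, ∑ s, C * (q x y * q x t * q x s + q x y * q y t * q y s + q x t * q y t * q t s + q x s * q
        y s * q t s + q x y * q y t * q t s + q x y * q y s * q t s + q x t * q y t * q y s + q x t * q y s * q t s + q x s * q y t * q y s + q x s *
            q y
        t * q t s + q x y * q x t * q t s + q x y * q x s * q t s + q x y * q x t * q y s + q x t * q x s * q y s + q x y * q x s * q y t + q x t * q
            x s
        * q y t) := Finset.sum_le_sum fun y _ => hy y
    _ = N * (C * ∑ y, ∑ t, ∑ s, (q x y * q x t * q x s + q x y * q y t * q y s + q x t * q y t * q t s + q x s * q y s * q t s + q x y * q y t * q t s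
        + q x y * q y s * q t s + q x t * q y t * q y s + q x t * q y s * q t s + q x s * q y t * q y s + q x s * q y t * q t s + q x y * q x t * q t
            s +
        q x y * q x s * q t s + q x y * q x t * q y s + q x t * q x s * q y s + q x y * q x s * q y t + q x t * q x s * q y t)) := by
        rw [← Finset.mul_sum]
        simp_rw [← Finset.mul_sum]
    _ ≤ N * (C * (16 * S ^ 3)) := mul_le_mul_of_nonneg_left (mul_le_mul_of_nonneg_left htree hC) hN0

end Trees

/-! ## §4. Toy -/

/-- Toy (§1's counting in numbers): a support of two values with the uniform bound `3` sums to at most `2·3`. -/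
example : ∑ _y ∈ ({0, 1} : Finset (Fin 3)), (3 : ℝ) ≤ (({0, 1} : Finset (Fin 3)).card : ℝ) * 3 :=
  card_mul_le _ _ fun _ _ => le_rfl

end Summit.QuantumFields.BalabanUV.T4Continuum.NE7b.SupSupportCountedQuadrupleSums
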